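import Summits.CriticalPhenomena.PercolationContinuityZ3.Theorems.PercAnnulusCrossingIICMeanDegreeStrict
import Summits.CriticalPhenomena.PercolationContinuityZ3.Theorems.PercAnnulusCrossingIICMeasureCorollaries
import Summits.CriticalPhenomena.PercolationContinuityZ3.Theorems.PercAnnulusCrossingIICPlanarKesten
import HarnessLib

/-!
# THE MEAN DEGREE OF THE IIC ROOT: lattice form, root-edge density `> 1/d`, and the PRE-LIMIT (census) form (lane RSW3, p1 gen 11)

builds on p205010 (kernel theorem, internal audit signed; external expert review pending) — used only through `θ(p_c) = 0` in the
`criticalProbI` / `ℤ²` corollaries; the `ν`-hypothesis theorems are stated at any `p` with `θ(p) = 0` and (A2)□ at aspect `(s, L)`, `2 ≤ s`.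

Seat `prim-rsw3-p1` (gen 11); memo `run/shared/lean/prim/rsw3/P1-QM.md` §24.  Helper file; no definitions, no sorries.  Consequences of
`PercAnnulusCrossingIICMeanDegreeStrict.lean` (`E_ν[deg 0] > 2`):

* `integral_latticeDegree_eq_sum` — `E_ν #{open lattice edges at 0} = Σ_{y ∼ 0} ν{s(0,y) open}` (any finite measure);
* **`iicMeasure_two_lt_integral_latticeDegree`** — Bochner form `2 < E_ν #{open lattice edges at the root}` (`d ≥ 2`);
* **`iicMeasure_inv_lt_real_rootEdge`** — **`1/d < ν{s(0,y) open}`** for every lattice neighbour `y` of the root (the `2d` marginals agree,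
  `iicMeasure_real_setOf_mk_mem_eq_of_adj`);
* **`iicMeasure_eventually_two_lt_condDegree`** — THE PRE-LIMIT (CENSUS) FORM: **for all large `n`,
  `2 < Σ_{y ∼ 0} P_p({s(0,y) open} ∩ {0 ↔ ∂ⁱⁿΛ(n)})/π_p(n) = E_p[deg(0) | 0 ↔ ∂ⁱⁿΛ(n)]`** (each root-edge marginal given the arm converges
  to the IIC marginal by the limit property); **`eventually_two_lt_condDegree_criticalProbI`** (measure-free: at `p_c(ℤ^d)` under (A2)□,
  `d ≥ 2`, via p1 gen 5's existence of the IIC measure); **`eventually_two_lt_condDegree_Z2`** (AT `p_c(ℤ²)`, UNCONDITIONALLY).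

The last two are finite-size, falsifiable statements: on `ℤ³` a conditional mean degree `E_{p_c}[deg 0 | 0 ↔ ∂ⁱⁿΛ(n)]` staying below `2`
(or a root-edge frequency below `1/3`) as `n → ∞` would refute (A2)□ at `p_c(ℤ³)` (LANE-4 input); census suggestion P1-QM §24.3.
References: D. Aldous, R. Lyons, EJP 12 (2007) §6; D. Basu, A. Sapozhnikov, ECP 22 (2017) no. 26, Thm. 1.1; H. Kesten, PTRF 73 (1986)
Thm. (3).
-/

noncomputable section

namespace Summit.CriticalPhenomena.PercolationContinuityZ3.Theorems.Crossing

open MeasureTheory Filter Topology Literature.Probability.Percolation Literature.Probability.LatticeModels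
open Literature.Probability.Percolation.DCT16
open Summit.CriticalPhenomena.PercolationContinuityZ3.Theorems.SurfaceTension
open scoped Literature.Probability.Percolation ENNReal

variable {d : ℕ}

/-- The expected number of open lattice edges at the root is the sum of the `2d` root-edge marginals (any finite measure). [folklore] -/
theorem integral_latticeDegree_eq_sum (ν : Measure (BondConfig (Site d))) [IsFiniteMeasure ν] :
    ∫ ω, ∑ y ∈ (zdGraph d).neighborFinset 0,
        {ω' : BondConfig (Site d) | s((0 : Site d), y) ∈ ω'}.indicator (1 : BondConfig (Site d) → ℝ) ω ∂ν =
      ∑ y ∈ (zdGraph d).neighborFinset 0, ν.real {ω : BondConfig (Site d) | s((0 : Site d), y) ∈ ω} := by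
  rw [integral_finsetSum ((zdGraph d).neighborFinset 0)
    (f := fun y' ω => {ω' : BondConfig (Site d) | s((0 : Site d), y') ∈ ω'}.indicator (1 : BondConfig (Site d) → ℝ) ω)
    fun y' _ => (integrable_const (1 : ℝ)).indicator (measurableSet_mem _)]
  simp_rw [integral_indicator_one (measurableSet_mem _)]

/-- **`E_ν #{open lattice edges at the root} > 2`** (Bochner form): `θ(p) = 0`, (A2)□ at aspect `(s,L)` (`2 ≤ s`), `ν` an IIC probability
measure at `p` (`0 < p`, `d ≥ 2`). [cite: AldousLyons2007, §6 Thm. 6.2] [cite: BasuSapozhnikov2017ECP, Thm. 1.1 and Remark 2.1] -/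
theorem iicMeasure_two_lt_integral_latticeDegree (hd : 2 ≤ d) (p : unitInterval) (hp : 0 < (p : ℝ))
    (hθ : theta (zdGraph d) 0 p = 0) {s L : ℕ} (hs : 2 ≤ s) {ϰ : ℝ} (hϰ : 0 < ϰ) (hA2 : SetToSetQuasiMultAspectAt d p s L ϰ)
    {ν : Measure (BondConfig (Site d))} [IsProbabilityMeasure ν]
    (hν : ∀ (F : Finset (Sym2 (Site d))) (E : Set (BondConfig (Site d))), MeasurableSet E → DeterminedBy E ↑F →
      Tendsto (fun n : ℕ => (bondPercolation (zdGraph d) p).real (E ∩ siteToBoundary d n) / oneArmProb d p n)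
        atTop (𝓝 (ν.real E))) :
    2 < ∫ ω, ∑ y ∈ (zdGraph d).neighborFinset 0,
      {ω' : BondConfig (Site d) | s((0 : Site d), y) ∈ ω'}.indicator (1 : BondConfig (Site d) → ℝ) ω ∂ν := by
  set g : BondConfig (Site d) → ℝ := fun ω => ∑ y ∈ (zdGraph d).neighborFinset 0,
    {ω' : BondConfig (Site d) | s((0 : Site d), y) ∈ ω'}.indicator (1 : BondConfig (Site d) → ℝ) ω with hg
  have hgm : Measurable g := Finset.measurable_sum _ fun y _ => measurable_one.indicator (measurableSet_mem _)
  have hg0 : ∀ ω, 0 ≤ g ω := fun ω => Finset.sum_nonneg fun y _ => Set.indicator_nonneg (fun _ _ => zero_le_one) _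
  have hgle : ∀ ω, g ω ≤ ((zdGraph d).neighborFinset 0).card := by
    intro ω
    calc g ω ≤ ∑ y ∈ (zdGraph d).neighborFinset 0, (1 : ℝ) :=
          Finset.sum_le_sum fun y _ => Set.indicator_apply_le' (fun _ => le_rfl) fun _ => zero_le_one
      _ = ((zdGraph d).neighborFinset 0).card := by rw [Finset.sum_const, nsmul_eq_mul, mul_one]
  have h2 := iicMeasure_two_lt_lintegral_degree hd p hp hθ hs hϰ hA2 hν
  have hae : (fun ω => ∑' y : Site d, {ω' : BondConfig (Site d) | (openGraph ω').Adj 0 y}.indicator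
      (1 : BondConfig (Site d) → ℝ≥0∞) ω) =ᵐ[ν] fun ω => ENNReal.ofReal (g ω) := by
    filter_upwards [iicMeasure_ae_subset_edgeSet p hν] with ω hω
    rw [tsum_indicator_openGraph_adj_eq_sum hω 0, hg]
    dsimp only
    rw [ENNReal.ofReal_sum_of_nonneg (f := fun y => {ω' : BondConfig (Site d) | s((0 : Site d), y) ∈ ω'}.indicator
      (1 : BondConfig (Site d) → ℝ) ω) fun y _ => Set.indicator_nonneg (fun _ _ => zero_le_one) _]
    refine Finset.sum_congr rfl fun y _ => ?_
    by_cases h : s((0 : Site d), y) ∈ ω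
    · rw [Set.indicator_of_mem (show ω ∈ {ω' : BondConfig (Site d) | s((0 : Site d), y) ∈ ω'} from h),
        Set.indicator_of_mem (show ω ∈ {ω' : BondConfig (Site d) | s((0 : Site d), y) ∈ ω'} from h), Pi.one_apply,
        Pi.one_apply, ENNReal.ofReal_one]
    · rw [Set.indicator_of_notMem (show ω ∉ {ω' : BondConfig (Site d) | s((0 : Site d), y) ∈ ω'} from h),
        Set.indicator_of_notMem (show ω ∉ {ω' : BondConfig (Site d) | s((0 : Site d), y) ∈ ω'} from h), ENNReal.ofReal_zero]
  rw [lintegral_congr_ae hae] at h2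
  rw [integral_eq_lintegral_of_nonneg_ae (Eventually.of_forall hg0) hgm.aestronglyMeasurable]
  have hne : ∫⁻ ω, ENNReal.ofReal (g ω) ∂ν ≠ ∞ := by
    refine ne_top_of_le_ne_top (b := ENNReal.ofReal ((zdGraph d).neighborFinset 0).card) ENNReal.ofReal_ne_top ?_
    calc ∫⁻ ω, ENNReal.ofReal (g ω) ∂ν ≤ ∫⁻ _, ENNReal.ofReal (((zdGraph d).neighborFinset 0).card : ℝ) ∂ν :=
          lintegral_mono fun ω => ENNReal.ofReal_le_ofReal (hgle ω)
      _ = ENNReal.ofReal (((zdGraph d).neighborFinset 0).card : ℝ) := by rw [lintegral_const, measure_univ, mul_one]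
  calc (2 : ℝ) = (2 : ℝ≥0∞).toReal := by norm_num
    _ < (∫⁻ ω, ENNReal.ofReal (g ω) ∂ν).toReal := (ENNReal.toReal_lt_toReal (by norm_num) hne).2 h2

/-- **EVERY LATTICE EDGE AT THE ROOT OF KESTEN'S IIC IS OPEN WITH PROBABILITY STRICTLY GREATER THAN `1/d`** (`θ(p) = 0`, (A2)□ at
aspect `(s,L)`, `2 ≤ s`, IIC probability measure at `p`, `0 < p`, `d ≥ 2`). [cite: AldousLyons2007, §6 Thm. 6.2]
[cite: BasuSapozhnikov2017ECP, Thm. 1.1 and Remark 2.1] -/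
theorem iicMeasure_inv_lt_real_rootEdge (hd : 2 ≤ d) (p : unitInterval) (hp : 0 < (p : ℝ)) (hθ : theta (zdGraph d) 0 p = 0)
    {s L : ℕ} (hs : 2 ≤ s) {ϰ : ℝ} (hϰ : 0 < ϰ) (hA2 : SetToSetQuasiMultAspectAt d p s L ϰ)
    {ν : Measure (BondConfig (Site d))} [IsProbabilityMeasure ν]
    (hν : ∀ (F : Finset (Sym2 (Site d))) (E : Set (BondConfig (Site d))), MeasurableSet E → DeterminedBy E ↑F →
      Tendsto (fun n : ℕ => (bondPercolation (zdGraph d) p).real (E ∩ siteToBoundary d n) / oneArmProb d p n)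
        atTop (𝓝 (ν.real E)))
    {y : Site d} (hy : (zdGraph d).Adj 0 y) :
    1 / (d : ℝ) < ν.real {ω | s((0 : Site d), y) ∈ ω} := by
  have h2 := iicMeasure_two_lt_integral_latticeDegree hd p hp hθ hs hϰ hA2 hν
  rw [integral_latticeDegree_eq_sum ν] at h2
  have hsum : ∑ y' ∈ (zdGraph d).neighborFinset 0, ν.real {ω : BondConfig (Site d) | s((0 : Site d), y') ∈ ω} =
      ((2 * d : ℕ) : ℝ) * ν.real {ω : BondConfig (Site d) | s((0 : Site d), y) ∈ ω} := by
    rw [Finset.sum_congr rfl fun y' hy' =>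
      iicMeasure_real_setOf_mk_mem_eq_of_adj p hν ((SimpleGraph.mem_neighborFinset _ _ _).1 hy') hy, Finset.sum_const,
      nsmul_eq_mul]
    have hc : ((zdGraph d).neighborFinset 0).card = 2 * d := card_neighborFinset_zdGraph_holds 0
    rw [hc]
  rw [hsum] at h2
  have hd' : (0 : ℝ) < d := by exact_mod_cast (by omega : 0 < d)
  rw [div_lt_iff₀ hd']
  push_cast at h2
  nlinarith

/-! ## The pre-limit form: `E_p[deg 0 | 0 ↔ ∂ⁱⁿΛ(n)] > 2` for all large `n` -/

/-- **THE CENSUS FORM**: `θ(p) = 0`, (A2)□ at aspect `(s,L)` (`2 ≤ s`), `ν` an IIC probability measure at `p` (`0 < p`, `d ≥ 2`) ⇒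
**for all large `n`, `2 < Σ_{y ∼ 0} P_p({s(0,y) open} ∩ {0 ↔ ∂ⁱⁿΛ(n)}) / π_p(n) = E_p[deg(0) | 0 ↔ ∂ⁱⁿΛ(n)]`** — the conditional mean degree
of the origin given the one-arm event to distance `n` eventually exceeds two (each term converges to the IIC marginal by the limit
property; the limit is `> 2`).  A finite-size, falsifiable consequence of the LANE-4 input (A2)□.
[cite: AldousLyons2007, §6 Thm. 6.2] [cite: BasuSapozhnikov2017ECP, Thm. 1.1 and Remark 2.1] -/
theorem iicMeasure_eventually_two_lt_condDegree (hd : 2 ≤ d) (p : unitInterval) (hp : 0 < (p : ℝ)) (hθ : theta (zdGraph d) 0 p = 0)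
    {s L : ℕ} (hs : 2 ≤ s) {ϰ : ℝ} (hϰ : 0 < ϰ) (hA2 : SetToSetQuasiMultAspectAt d p s L ϰ)
    {ν : Measure (BondConfig (Site d))} [IsProbabilityMeasure ν]
    (hν : ∀ (F : Finset (Sym2 (Site d))) (E : Set (BondConfig (Site d))), MeasurableSet E → DeterminedBy E ↑F →
      Tendsto (fun n : ℕ => (bondPercolation (zdGraph d) p).real (E ∩ siteToBoundary d n) / oneArmProb d p n)
        atTop (𝓝 (ν.real E))) :
    ∀ᶠ n : ℕ in atTop, 2 < ∑ y ∈ (zdGraph d).neighborFinset 0,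
      (bondPercolation (zdGraph d) p).real ({ω : BondConfig (Site d) | s((0 : Site d), y) ∈ ω} ∩ siteToBoundary d n) / oneArmProb d p n := by
  have h2 := iicMeasure_two_lt_integral_latticeDegree hd p hp hθ hs hϰ hA2 hν
  rw [integral_latticeDegree_eq_sum ν] at h2
  have hlim : Tendsto (fun n : ℕ => ∑ y ∈ (zdGraph d).neighborFinset 0,
      (bondPercolation (zdGraph d) p).real ({ω : BondConfig (Site d) | s((0 : Site d), y) ∈ ω} ∩ siteToBoundary d n) / oneArmProb d p n)
      atTop (𝓝 (∑ y ∈ (zdGraph d).neighborFinset 0, ν.real {ω : BondConfig (Site d) | s((0 : Site d), y) ∈ ω})) := by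
    refine tendsto_finsetSum _ fun y _ => ?_
    obtain ⟨F, hF⟩ := isLocalEvent_setOf_mem (ι := Sym2 (Site d)) s((0 : Site d), y)
    exact hν F _ (measurableSet_mem _) hF
  exact hlim.eventually (Ioi_mem_nhds h2)

/-- **At `p_c(ℤ^d)` under (A2)□** (`d ≥ 2`, aspect `(s,L)`, `2 ≤ s`), measure-free statement: **for all large `n`,
`E_{p_c}[deg(0) | 0 ↔ ∂ⁱⁿΛ(n)] > 2`** (an IIC measure exists by p1 gen 5, `exists_iicMeasure_criticalProbI_of_setToSetQuasiMultAspectAt`).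
[cite: AldousLyons2007, §6 Thm. 6.2] [cite: BasuSapozhnikov2017ECP, Thm. 1.1] -/
theorem eventually_two_lt_condDegree_criticalProbI (hd : 2 ≤ d) {s L : ℕ} (hs : 2 ≤ s) {ϰ : ℝ} (hϰ : 0 < ϰ)
    (hA2 : SetToSetQuasiMultAspectAt d (criticalProbI d) s L ϰ) :
    ∀ᶠ n : ℕ in atTop, 2 < ∑ y ∈ (zdGraph d).neighborFinset 0,
      (bondPercolation (zdGraph d) (criticalProbI d)).real ({ω : BondConfig (Site d) | s((0 : Site d), y) ∈ ω} ∩ siteToBoundary d n) /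
        oneArmProb d (criticalProbI d) n := by
  obtain ⟨ν, hνP, hν, -⟩ := exists_iicMeasure_criticalProbI_of_setToSetQuasiMultAspectAt hd hs hϰ hA2
  have hpc : 0 < ((criticalProbI d : unitInterval) : ℝ) := by
    exact_mod_cast Literature.Barriers.CriticalPhenomena.criticalProbI_pos' (d := d) (by omega)
  exact iicMeasure_eventually_two_lt_condDegree hd (criticalProbI d) hpc (CSH.percolationContinuity_allDimensions d hd) hs hϰ hA2 hν

/-- **AT `p_c(ℤ²) = 1/2`, UNCONDITIONALLY: for all large `n`, the mean degree of the origin conditioned on `0 ↔ ∂ⁱⁿΛ(n)` exceeds two** —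
`2 < Σ_{y ∼ 0} P_{1/2}({s(0,y) open} ∩ {0 ↔ ∂ⁱⁿΛ(n)})/π(n)`. [cite: Kesten1986, Thm. (3)] [cite: AldousLyons2007, §6 Thm. 6.2] -/
theorem eventually_two_lt_condDegree_Z2 :
    ∀ᶠ n : ℕ in atTop, 2 < ∑ y ∈ (zdGraph 2).neighborFinset 0,
      (bondPercolation (zdGraph 2) (criticalProbI 2)).real ({ω : BondConfig (Site 2) | s((0 : Site 2), y) ∈ ω} ∩ siteToBoundary 2 n) /
        oneArmProb 2 (criticalProbI 2) n := by
  obtain ⟨ϰ, hϰ, hA2⟩ := exists_setToSetQuasiMultAspectAt_two_of_criticalProbI_le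
  exact eventually_two_lt_condDegree_criticalProbI (d := 2) le_rfl (by norm_num) hϰ (hA2 _ le_rfl)

end Summit.CriticalPhenomena.PercolationContinuityZ3.Theorems.Crossing

end
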